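import Literature.NumberTheory.EllipticCurves.CastellaGrossiSkinner2025.TwoLineEulerCharacteristic
import Literature.NumberTheory.EllipticCurves.CastellaGrossiSkinner2025.PerrinRiouMainConjectureProofs
import Literature.NumberTheory.EllipticCurves.CastellaGrossiSkinner2025.IsogenyInvariance
import Literature.NumberTheory.EllipticCurves.CastellaGrossiSkinner2025.GreenbergPAdicLFunction
import Literature.NumberTheory.EllipticCurves.CastellaGrossiLeeSkinner2022.AnticyclotomicControlTorsionFree
import Literature.NumberTheory.EllipticCurves.CastellaGrossiLeeSkinner2022.IMC2DivisibilityAndBDPValueFrame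
import Literature.NumberTheory.EllipticCurves.KellerYin2024.AnomalousAnticyclotomicMainConjecture
import Literature.NumberTheory.EllipticCurves.NonvanishingTwistsBumpFriedbergHoffstein
import Literature.NumberTheory.EllipticCurves.Rank1Residual.X1MainConjecture
import Literature.NumberTheory.EllipticCurves.AtkinLehnerFrickeLevelProofs
import Literature.NumberTheory.EllipticCurves.AnalyticRankModularityProofs
import Literature.NumberTheory.EllipticCurves.YanZhu2026.GreenbergMainTheoremsAnyRootGuarded
import Literature.NumberTheory.EllipticCurves.YanZhu2026.GreenbergDivisibilityProofs
import Literature.NumberTheory.EllipticCurves.YanZhu2026.TwistGoodOrdinaryProofs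
import Literature.NumberTheory.EllipticCurves.KatoRankBoundProofs
import Summits.BirchSwinnertonDyer.BirchSwinnertonDyer.Theorems.SmallImageMuTransferMuZeroCMKatzFrame
import Summits.BirchSwinnertonDyer.BirchSwinnertonDyer.Theorems.EisensteinPrimesTwoVariableGeneratorPair
import Summits.BirchSwinnertonDyer.BirchSwinnertonDyer.Theorems.SignedBaseChangeTwistPairGreenbergProductDivisibilityStubFrameData
import Summits.BirchSwinnertonDyer.Rank1Residual.X11b.KolyvaginHpointsAssembly
import Literature.NumberTheory.EllipticCurves.ZpExtensionUnitTwistProofs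
import Literature.NumberTheory.EllipticCurves.ZpExtensionAnticyclotomicHoldsProofs
import Summits.BirchSwinnertonDyer.Rank1Residual.X1.GoodLatticeExists
import Summits.BirchSwinnertonDyer.Rank1Residual.X1.KellerYinGoodLattice
import Summits.BirchSwinnertonDyer.Rank1Residual.Partition.AnticyclotomicControlJSWEmbAt
import Literature.NumberTheory.EllipticCurves.IsogenyGroundFieldExtension
import Literature.NumberTheory.EllipticCurves.IsogenyMordellWeilRankProofs
import Literature.NumberTheory.EllipticCurves.SelmerCorankIsogenyProofs
import Literature.NumberTheory.EllipticCurves.IwasawaLeadingTermProofs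
import Literature.NumberTheory.EllipticCurves.HeegnerPointsClassesProofs
import Literature.NumberTheory.EllipticCurves.HeegnerPointsRationalityGeneralLevelProofs
import Literature.NumberTheory.EllipticCurves.HeegnerPointsImaginaryQuadraticProofs
import Literature.NumberTheory.QuadraticFields.HeegnerCondition
import Literature.NumberTheory.EllipticCurves.Rubin1991.TwoVariableCMLines
import Literature.NumberTheory.EllipticCurves.AnticyclotomicRankinSelbergPAdicLFunction
import Literature.NumberTheory.EllipticCurves.ModularityVersionApProofs
import Literature.NumberTheory.EllipticCurves.ModularCurveManinSemistableBridgeProofs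
import Summits.BirchSwinnertonDyer.BirchSwinnertonDyer.Theorems.SignedBaseChangeK2RDivisibilityDescent
import Literature.NumberTheory.EllipticCurves.IsogenySelmerInfty
import Literature.NumberTheory.EllipticCurves.GreenbergVatsal2000.GreenbergSelmerGroups
import Literature.NumberTheory.EllipticCurves.Castella2018.AnticyclotomicSelmerDualModuleFinite
import Literature.NumberTheory.EllipticCurves.IwasawaDualFunctorialityProofs
import Literature.NumberTheory.EllipticCurves.IsogenyDualProofs
import Literature.NumberTheory.EllipticCurves.Kato2004.DivisibilityInputsZetaLine
import Literature.NumberTheory.EllipticCurves.KatoDivisibilityColemanKernelSkeletonProofs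
import Summits.BirchSwinnertonDyer.BirchSwinnertonDyer.Theorems.EisensteinPrimesMazurMCOnX1RankZeroInterludeRoadBReduction
import Summits.BirchSwinnertonDyer.BirchSwinnertonDyer.Theorems.EisensteinPrimesMazurMCOnX1RankZeroInterludeDefs
import HarnessLib

/-!
# Crux `MazurMCOnX1RankZero` (item stmt-BirchSwinnertonDyer-19035), line `interlude_with_torsion`: the XI-ELIMINATION (four-term identities ⟹ the two divisibility transfers of `prop:equiv`) and ISO (transport of the node's conclusion along the isogeny class over `K_∞⁺`)

Cell `bsd-eis` (host `run/shared/lean/pub/bsd-eis/`), LEAD `cruxlead-19035` (g0); `--supports` stmt-BirchSwinnertonDyer-19035 as a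
HELPER. Part of the move of the SORRY-FREE recomposition of the skeleton of record v8
(`Cruxes/MazurMCOnX1RankZero/Lines/interlude_with_torsion.lean`; mathematics by the ideator bsd-idea-11 g6–g15 and, for the descent, LEAD
bsd-line-x1-p2 — carried VERBATIM over the tree currencies of `Theorems/…InterludeDefs.lean`) into `Theorems/`, so that crux 5
obtains a BY-NAME conditional closure in the tree whose hypotheses are token-identical to the registered stubs. Kernel-checked;
every theorem here is either unconditional plumbing or an implication between the line's currencies; NOTHING is asserted about BSD,
Mazur's main conjecture or IMC2, and no registered stub is proved here.

WHAT. `crossTransfer_of_fourTerm`, `crossTransferSome_of_fourTermSome`, `fourTermSome_of_torsionFree`, `crossTransferSome_of_torsionFree`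
(abstract elimination `transfers_of_fourTermIdentities` in `Λ = ℤ_p⟦T⟧` with `J : ℤ_p → 𝓞_{ℂ_p}`); `isoTransportK_of_published : PublishedFacts → IsoTransportK`
(CGS Prop. 3.3.1 at `V` and at `E`, Prop. 3.2.3 over `ℚ_∞`, Kato–Wuthrich torsion).
[cite: CastellaGrossiSkinner2025, Prop. 4.2.1 (proof), Prop. 3.2.3, Prop. 3.3.1, §6 (TeX l. 2190)] [cite: PerrinRiou1987BSMF, Appendice, Lemme (p. 455)]
-/

set_option linter.dupNamespace false
set_option autoImplicit false

noncomputable section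

open scoped Classical MatrixGroups ModularForm

open CongruenceSubgroup WeierstrassCurve NumberField IsDedekindDomain Field
  Literature.NumberTheory.EllipticCurves Literature.NumberTheory.EllipticCurves.ModularForms
  Literature.NumberTheory.EllipticCurves.Rank1Residual Literature.NumberTheory.GaloisRepresentations
  Literature.NumberTheory.EllipticCurves.CyclotomicZp Literature.NumberTheory.EllipticCurves.Castella2018
  Literature.NumberTheory.QuadraticFields

namespace Summit.BirchSwinnertonDyer.BirchSwinnertonDyer.Theorems.InterludeWithTorsion

/-- In a commutative domain: if `a ∈ I`, `b ∈ J`, `b ≠ 0` and `I · J = (a b)`, then `I = (a)`. (Verbatim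
the private helper of `PerrinRiouMainConjectureProofs`.) [folklore] -/
private theorem eq_span_singleton_of_mul_eq_span_mul {R : Type*} [CommRing R] [IsDomain R]
    {I J : Ideal R} {a b : R} (ha : a ∈ I) (hb : b ∈ J) (hb0 : b ≠ 0)
    (h : I * J = Ideal.span {a * b}) : I = Ideal.span {a} := by
  refine le_antisymm (fun x hx ↦ ?_) ((Ideal.span_singleton_le_iff_mem _).mpr ha)
  have hxb : x * b ∈ Ideal.span {a * b} := h ▸ Ideal.mul_mem_mul hx hb
  obtain ⟨y, hy⟩ := Ideal.mem_span_singleton'.mp hxb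
  have hx' : x = y * a := by
    have : (x - y * a) * b = 0 := by rw [sub_mul, mul_assoc, hy, sub_self]
    rcases mul_eq_zero.mp this with h0 | h0
    · exact sub_eq_zero.mp h0
    · exact absurd h0 hb0
  exact hx' ▸ Ideal.mul_mem_left _ _ (Ideal.mem_span_singleton_self a)


/-- **The elimination behind `prop:equiv` (abstract form, PROVED; long form: memo Appendix H)**: in `Λ = ℤ_p⟦T⟧` with `J : ℤ_p → 𝓞_{ℂ_p}`,
principal ideals `I_D = (d) ≠ ⊥`, `I_X = (x)`, a nonzero `L ∈ 𝓞⟦T⟧` and `G₀ ∈ Λ`: the four-term identities `(G₀ b) = (a)·I_D`,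
`(L · J b) = (J a)·(J I_X)` (`a, b ≠ 0`) give (⊇) `G₀ ∈ I_D ⟹ (L) ⊆ J I_X` and (⊆) `J I_X ⊆ (L) ⟹ I_D ⊆ (G₀)` (divisibility descent
`iwasawaAlgebra_dvd_of_map_dvd_map_padicComplexInt`; in print: flatness of `Λ → Λ^{ur}`).
[cite: CastellaGrossiSkinner2025, Prop. 4.2.1 (proof: "taking characteristic ideals … the result follows")] -/
private theorem transfers_of_fourTermIdentities {p : ℕ} [Fact p.Prime] {J : ℤ_[p] →+* PadicComplexInt p}
    (hJ : ∀ x : ℤ_[p], ((J x : PadicComplexInt p) : ℂ_[p]) = ((x : ℚ_[p]) : ℂ_[p]))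
    {L : PowerSeries (PadicComplexInt p)} (hL : L ≠ 0) {G₀ : IwasawaAlgebra p} {TD TX : Prop}
    {ID IX : Ideal (IwasawaAlgebra p)} (hIDp : ID.IsPrincipal) (hIXp : IX.IsPrincipal) (hID0 : ID ≠ ⊥)
    (hmain : TD ∨ TX → TD ∧ TX ∧ ∃ a b : IwasawaAlgebra p, a ≠ 0 ∧ b ≠ 0 ∧
      Ideal.span {G₀ * b} = Ideal.span {a} * ID ∧
      Ideal.span {L * PowerSeries.map J b} = Ideal.span {PowerSeries.map J a} * IX.map (PowerSeries.map J)) :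
    (TD → G₀ ∈ ID → Ideal.span {L} ≤ IX.map (PowerSeries.map J)) ∧
    (TX → IX.map (PowerSeries.map J) ≤ Ideal.span {L} → ID ≤ Ideal.span {G₀}) := by
  have hJinj : Function.Injective (PowerSeries.map J : IwasawaAlgebra p → PowerSeries (PadicComplexInt p)) :=
    PowerSeries.map_injective J (Literature.NumberTheory.EllipticCurves.structureMap_injective hJ)
  obtain ⟨d, hd⟩ := hIDp.principal
  obtain ⟨x, hx⟩ := hIXp.principal
  have hdD : ID = Ideal.span {d} := hd
  have hxX : IX = Ideal.span {x} := hx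
  have hd0 : d ≠ 0 := by
    intro h0
    apply hID0
    rw [hdD, Ideal.span_singleton_eq_bot]
    exact h0
  have hmapX : IX.map (PowerSeries.map J) = Ideal.span {PowerSeries.map J x} := by
    rw [hxX, Ideal.map_span, Set.image_singleton]
  constructor
  · -- (⊇): `X_ord`-side divisibility ⟹ Greenberg-side divisibility
    intro hDt hG₀mem
    obtain ⟨-, -, a, b, -, hb, he_ord, he_Gr⟩ := hmain (Or.inl hDt)
    rw [hdD] at hG₀mem he_ord
    obtain ⟨c, hc⟩ := Ideal.mem_span_singleton'.mp hG₀mem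
    rw [Ideal.span_singleton_mul_span_singleton] at he_ord
    have h1 : Associated (G₀ * b) (a * d) := Ideal.span_singleton_eq_span_singleton.mp he_ord
    have h2 : Associated (d * (c * b)) (d * a) := by
      have e1 : d * (c * b) = G₀ * b := by rw [← hc]; ring
      rw [e1, mul_comm d a]; exact h1
    have h3 : Associated (c * b) a := Associated.of_mul_left h2 (Associated.refl d) hd0
    obtain ⟨u, hu⟩ := h3
    have hJa : PowerSeries.map J a =
        PowerSeries.map J c * PowerSeries.map J b * PowerSeries.map J (u : IwasawaAlgebra p) := by
      rw [← hu, map_mul, map_mul]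
    rw [hmapX, Ideal.span_singleton_mul_span_singleton] at he_Gr
    have h5 : Associated (L * PowerSeries.map J b) (PowerSeries.map J a * PowerSeries.map J x) :=
      Ideal.span_singleton_eq_span_singleton.mp he_Gr
    have hJb0 : PowerSeries.map J b ≠ 0 := fun h0 ↦ hb (hJinj (by rw [h0, map_zero]))
    have h6 : Associated (PowerSeries.map J b * L)
        (PowerSeries.map J b *
          (PowerSeries.map J c * PowerSeries.map J x * PowerSeries.map J (u : IwasawaAlgebra p))) := by
      have e1 : PowerSeries.map J b * L = L * PowerSeries.map J b := mul_comm _ _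
      have e2 : PowerSeries.map J b *
          (PowerSeries.map J c * PowerSeries.map J x * PowerSeries.map J (u : IwasawaAlgebra p)) =
          PowerSeries.map J a * PowerSeries.map J x := by rw [hJa]; ring
      rw [e1, e2]; exact h5
    have h7 : Associated L
        (PowerSeries.map J c * PowerSeries.map J x * PowerSeries.map J (u : IwasawaAlgebra p)) :=
      Associated.of_mul_left h6 (Associated.refl _) hJb0
    rw [hmapX, Ideal.span_singleton_le_span_singleton]
    refine Dvd.dvd.trans ?_ h7.symm.dvd
    exact ⟨PowerSeries.map J c * PowerSeries.map J (u : IwasawaAlgebra p), by ring⟩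
  · -- (⊆): Greenberg-side divisibility ⟹ `X_ord`-side divisibility (descent `𝓞⟦T⟧ → ℤ_p⟦T⟧`)
    intro hXt hle
    obtain ⟨-, -, a, b, ha, -, he_ord, he_Gr⟩ := hmain (Or.inr hXt)
    rw [hmapX, Ideal.span_singleton_le_span_singleton] at hle
    obtain ⟨e, he⟩ := hle
    rw [hmapX, Ideal.span_singleton_mul_span_singleton] at he_Gr
    have h5 : Associated (L * PowerSeries.map J b) (PowerSeries.map J a * PowerSeries.map J x) :=
      Ideal.span_singleton_eq_span_singleton.mp he_Gr
    have h6 : Associated (L * PowerSeries.map J b) (L * (PowerSeries.map J a * e)) := by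
      have e1 : L * (PowerSeries.map J a * e) = PowerSeries.map J a * PowerSeries.map J x := by
        rw [he]; ring
      rw [e1]; exact h5
    have h7 : Associated (PowerSeries.map J b) (PowerSeries.map J a * e) :=
      Associated.of_mul_left h6 (Associated.refl _) hL
    have h8 : PowerSeries.map J a ∣ PowerSeries.map J b := (Dvd.intro e rfl).trans h7.symm.dvd
    have h9 : a ∣ b :=
      Summit.BirchSwinnertonDyer.BirchSwinnertonDyer.Theorems.SignedBaseChangeK2RDivisibilityDescent.iwasawaAlgebra_dvd_of_map_dvd_map_padicComplexInt
        hJ h8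
    obtain ⟨q, hq⟩ := h9
    rw [hdD, Ideal.span_singleton_mul_span_singleton] at he_ord
    have h1 : Associated (G₀ * b) (a * d) := Ideal.span_singleton_eq_span_singleton.mp he_ord
    have h2 : Associated (a * (G₀ * q)) (a * d) := by
      have e1 : a * (G₀ * q) = G₀ * b := by rw [hq]; ring
      rw [e1]; exact h1
    have h3 : Associated (G₀ * q) d := Associated.of_mul_left h2 (Associated.refl a) ha
    rw [hdD, Ideal.span_singleton_le_span_singleton]
    exact (Dvd.intro q rfl).trans h3.dvd

/-- **XI from XI′ — PROVED (rev 4; rev 5: via the abstract elimination)**: the two transfers at a `K`-torsion-free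
member from the four-term identities there. Kept as the torsion-free (T0-shape) road; no stub feeds it in rev 5.
[cite: CastellaGrossiSkinner2025, Prop. 4.2.1 (proof)] -/
theorem crossTransfer_of_fourTerm (h4 : FourTermAtTorsionFreeLattice) :
    CrossTransferAtTorsionFreeLattice := by
  intro W _ _ p _ K _ _ κ γ h _ f hf _ Φ _
  obtain ⟨V, hVe, hVm, hWV, hgood, hred, hheeg, htf, hmain⟩ := h4 W p K κ γ h f hf Φ
  refine ⟨V, hVe, hVm, hWV, hgood, hred, hheeg, htf,
    fun hG V' _ _ hV' _ g hg ϖ hϖ ϖ' hϖ' D G₀ hG₀ ↦ ?_⟩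
  exact transfers_of_fourTermIdentities Φ.J_compat hG (charIdeal_isPrincipal_holds p D.X)
    (charIdeal_isPrincipal_holds p (AcSelmer.XAc (V.baseChange K) p κ Φ.vbar ∅ Φ.γ₁))
    (Module.charIdeal_ne_bot (IwasawaAlgebra p) D.X) (hmain hG V' hV' g hg ϖ hϖ ϖ' hϖ' D G₀ hG₀)

/-- **XI° from XI″ — PROVED (rev 5)**: the two transfers at the member of XI″ (print: `E_•`), no `K`-torsion
hypothesis anywhere, by the same elimination. [cite: CastellaGrossiSkinner2025, Prop. 4.2.1 (proof), §5 Steps 2–3] -/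
theorem crossTransferSome_of_fourTermSome (h4 : FourTermAtSomeLattice) : CrossTransferAtSomeLattice := by
  intro W _ _ p _ K _ _ κ γ h _ f hf _ Φ _
  obtain ⟨V, hVe, hVm, hWV, hgood, hred, hheeg, hmain⟩ := h4 W p K κ γ h f hf Φ
  refine ⟨V, hVe, hVm, hWV, hgood, hred, hheeg, fun hG V' _ _ hV' _ g hg ϖ hϖ ϖ' hϖ' D G₀ hG₀ ↦ ?_⟩
  exact transfers_of_fourTermIdentities Φ.J_compat hG (charIdeal_isPrincipal_holds p D.X)
    (charIdeal_isPrincipal_holds p (AcSelmer.XAc (V.baseChange K) p κ Φ.vbar ∅ Φ.γ₁))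
    (Module.charIdeal_ne_bot (IwasawaAlgebra p) D.X) (hmain hG V' hV' g hg ϖ hϖ ϖ' hϖ' D G₀ hG₀)

/-- XI′ ⟹ XI″ and XI ⟹ XI° (forget the torsion clause): the rev-4 atom is a special case of the rev-5 atom, so a
prover landing XI′ also lands XI″. -/
theorem fourTermSome_of_torsionFree (h4 : FourTermAtTorsionFreeLattice) : FourTermAtSomeLattice := by
  intro W _ _ p _ K _ _ κ γ h _ f hf _ Φ _
  obtain ⟨V, hVe, hVm, hWV, hgood, hred, hheeg, -, hmain⟩ := h4 W p K κ γ h f hf Φ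
  exact ⟨V, hVe, hVm, hWV, hgood, hred, hheeg, hmain⟩

/-- XI (at a `K`-torsion-free member) implies XI° (at some member): forget the torsion-freeness conjunct.
[cite: CastellaGrossiSkinner2025, Prop. 4.2.1, §5 Steps 2–3] -/
theorem crossTransferSome_of_torsionFree (hX : CrossTransferAtTorsionFreeLattice) :
    CrossTransferAtSomeLattice := by
  intro W _ _ p _ K _ _ κ γ h _ f hf _ Φ _
  obtain ⟨V, hVe, hVm, hWV, hgood, hred, hheeg, -, hT⟩ := hX W p K κ γ h f hf Φ
  exact ⟨V, hVe, hVm, hWV, hgood, hred, hheeg, hT⟩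

/-- Transport of a cusp form along an equality of levels (bookkeeping for `Γ₀(N_{V'}) = Γ₀(N_{W'})`). -/
private theorem exists_cuspForm_of_level_eq (p : ℕ) [Fact p.Prime] {N M : ℕ} (h : M = N)
    [NeZero N] [NeZero M] (g : CuspForm (Gamma0 N) 2) :
    ∃ g' : CuspForm (Gamma0 M) 2, plusPeriod g' = plusPeriod g ∧
      (∀ x : ℚ_[p], padicLFunction g' x = padicLFunction g x) ∧
      ∀ (V : WeierstrassCurve ℚ) [V.IsElliptic], IsNewformOf V g → IsNewformOf V g' := by
  subst h
  exact ⟨g, rfl, fun _ ↦ rfl, fun _ _ h ↦ h⟩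

/-- **PROVED (rev 2): isogeny transport of the Interlude node over `K_∞⁺` inside the class** (was `stub_isoTransportK`, M plumbing;
long form: memo Appendix H). Prop. 3.3.1 at `V` with Kato–Wuthrich lower bounds on both factors turns the node's product formula at `V` into
Mazur's equality over `ℚ_∞` for `V` and for a minimal model `V'` of `V^K` (periods from Perrin-Riou's ratios, Prop. 3.2.3); Prop. 3.2.3
("invariant under isogenies") moves both to `W ∼ V`, `W' ∼ V'`; Prop. 3.3.1 at `W` recombines; `ϖϖ' = 0` is contradictory.
[cite: CastellaGrossiSkinner2025, Prop. 3.3.1, Prop. 3.2.3] [cite: PerrinRiou1987BSMF, Appendice, Lemme (p. 455)]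
[cite: Wuthrich2014, Thm. 16] [cite: CremonaAlgorithms1997, §3.9 (p. 87)] [cite: AtkinLehner1970, Thm. 4] -/
theorem isoTransportK_of_published : PublishedFacts → IsoTransportK := by
  intro hpub W _ _ p _ K _ _ κK γK h hN f hf V _ _ hiso hgoodV hredV hV
  obtain ⟨-, hmodP, hmod, -, h331, hW16, h323, -⟩ := hpub
  intro ϖ hϖ W' _ _ hW' _ g hg ϖ' hϖ' DK
  have hpP : p.Prime := Fact.out
  have hp : 2 < p := h.two_lt
  have hp2 : p ≠ 2 := by omega
  have hK : IsImaginaryQuadratic K := h.iq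
  have hordW : IsOrdinaryAt W p := goodOrd_of_red_of_good W p hp h.good h.red
  have hordV : IsOrdinaryAt V p := goodOrd_of_red_of_good V p hp hgoodV hredV
  -- the cyclotomic line of `ℚ` with a normalised variable
  obtain ⟨κ, hκ, γ, hγ, hγ'⟩ := exists_isCyclotomic_isTopGenerator_isCyclotomicVariable_holds p
  -- the twists: `W'` (given) of `W`, a minimal model `V'` of `V^K`; both reducible good ordinary at `p`
  have hd : (NumberField.discr K : ℚ) ≠ 0 := by exact_mod_cast NumberField.discr_ne_zero K
  obtain ⟨C, hC⟩ := hW'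
  obtain ⟨V', _, _, C', hC'⟩ := exists_isGloballyMinimal_smul_eq_quadraticTwist V hd
  have hsqf : Squarefree (NumberField.discr K) := by
    rcases Quadratic.isFundamentalDiscriminant_discr hK.1 with hF | hF
    · exact hF.2.1
    · exfalso
      obtain ⟨k, hk⟩ := hF.1
      have h2 := Int.odd_iff.mp h.discr_odd
      omega
  have hpd : ¬ (p : ℤ) ∣ NumberField.discr K :=
    not_dvd_discr_of_ncard_primesOver_eq_two hK.1 hpP h.split
  have hordW' : IsOrdinaryAt W' p := isOrdinaryAt_of_smul_eq_quadraticTwist W W' hsqf hC p hp2 hpd hordW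
  have hredW' : Red W' p := not_hasIrreducibleModPGaloisRep_twist h.red hd W' C hC
  have hordV' : IsOrdinaryAt V' p := isOrdinaryAt_of_smul_eq_quadraticTwist V V' hsqf hC' p hp2 hpd hordV
  have hredV' : Red V' p := not_hasIrreducibleModPGaloisRep_twist hredV hd V' C' hC'
  -- isogenies `V ∼ W`, `V' ∼ W'` (twisting commutes with isogenies)
  have hisoVW : IsIsogenous V W := hiso.symm_of_charZero
  haveI := W.isElliptic_quadraticTwist hd
  haveI := V.isElliptic_quadraticTwist hd
  have hiso' : IsIsogenous V' W' :=
    IsIsogenous.trans' (IsIsogenous.trans' (isIsogenous_of_smul_eq hC') (hisoVW.quadraticTwist hd))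
      (isIsogenous_of_smul_eq hC).symm_of_charZero
  -- levels: `N_V = N_W`, `N_{V'} = N_{W'}` (strong multiplicity one), newforms of `V`, `V'`
  haveI : NeZero (V.conductorNorm ℤ) := ⟨(V.conductorNorm_pos_holds).ne'⟩
  haveI : NeZero (V'.conductorNorm ℤ) := ⟨(V'.conductorNorm_pos_holds).ne'⟩
  have hfV : IsNewformOf V f := hf.of_isIsogenous hisoVW
  have hNV : V.conductorNorm ℤ = W.conductorNorm ℤ := by
    obtain ⟨f₀, hf₀⟩ := hmod V
    exact hf₀.level_eq_level hfV
  have hNV' : V'.conductorNorm ℤ = W'.conductorNorm ℤ := by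
    obtain ⟨g₀, hg₀⟩ := hmod V'
    exact hg₀.level_eq_level (hg.of_isIsogenous hiso')
  obtain ⟨gV, hgVper, hgVL, hgVnew⟩ := exists_cuspForm_of_level_eq p hNV' g
  have hgV : IsNewformOf V' gV := hgVnew V' (hg.of_isIsogenous hiso')
  have hHV : SatisfiesHeegnerHypothesis (V.conductorNorm ℤ) K := hNV ▸ h.heeg
  -- dual data over `ℚ_∞` and their torsion (Kato–Wuthrich)
  let DW : W.SelmerDualData κ γ := W.selmerDualData κ hγ
  let DW' : W'.SelmerDualData κ γ := W'.selmerDualData κ hγ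
  let DV : V.SelmerDualData κ γ := V.selmerDualData κ hγ
  let DV' : V'.SelmerDualData κ γ := V'.selmerDualData κ hγ
  obtain ⟨hDWt, -⟩ := hW16 W p hp2 hordW h.red hκ hγ hγ' hf DW ϖ hϖ
  obtain ⟨hDW't, -⟩ := hW16 W' p hp2 hordW' hredW' hκ hγ hγ' hg DW' ϖ' hϖ'
  obtain ⟨MV⟩ := hmodP V
  obtain ⟨ϖb, -, hϖb, -⟩ := MV.exists_rat_mul_realPeriodRat_eq_plusPeriod
  obtain ⟨hDVt, -⟩ := hW16 V p hp2 hordV hredV hκ hγ hγ' MV.isNewformOf DV ϖb hϖb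
  obtain ⟨MV'⟩ := hmodP V'
  obtain ⟨ϖb', -, hϖb', -⟩ := MV'.exists_rat_mul_realPeriodRat_eq_plusPeriod
  obtain ⟨hDV't, -⟩ := hW16 V' p hp2 hordV' hredV' hκ hγ hγ' MV'.isNewformOf DV' ϖb' hϖb'
  -- Perrin-Riou's period ratios: `Ω_V = r Ω_W`, `Ω_{V'} = r' Ω_{W'}`
  obtain ⟨FW, hFW⟩ := (charIdeal_isPrincipal_holds p DW.X).principal
  obtain ⟨FV, hFV⟩ := (charIdeal_isPrincipal_holds p DV.X).principal
  obtain ⟨FW', hFW'⟩ := (charIdeal_isPrincipal_holds p DW'.X).principal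
  obtain ⟨FV', hFV'⟩ := (charIdeal_isPrincipal_holds p DV'.X).principal
  obtain ⟨r, -, hΩ, -⟩ := h323 W V p hp2 hordW hordV hiso κ γ hκ hγ DW DV hDWt hDVt FW FV hFW hFV
  obtain ⟨r', -, hΩ', -⟩ :=
    h323 W' V' p hp2 hordW' hordV' hiso'.symm_of_charZero κ γ hκ hγ DW' DV' hDW't hDV't FW' FV' hFW' hFV'
  have hr0 : r ≠ 0 := by
    rintro rfl
    rw [Rat.cast_zero, zero_mul] at hΩ
    exact (V.realPeriodRat_pos_holds).ne' hΩ
  have hr0' : r' ≠ 0 := by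
    rintro rfl
    rw [Rat.cast_zero, zero_mul] at hΩ'
    exact (V'.realPeriodRat_pos_holds).ne' hΩ'
  have hϖV : ((ϖ / r : ℚ) : ℝ) * V.realPeriodRat = plusPeriod f := by
    rw [← hϖ, hΩ, Rat.cast_div, ← mul_assoc, div_mul_cancel₀ _ (by exact_mod_cast hr0 : (r : ℝ) ≠ 0)]
  have hϖV' : ((ϖ' / r' : ℚ) : ℝ) * V'.realPeriodRat = plusPeriod gV := by
    rw [hgVper, ← hϖ', hΩ', Rat.cast_div, ← mul_assoc,
      div_mul_cancel₀ _ (by exact_mod_cast hr0' : (r' : ℝ) ≠ 0)]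
  have hϖ'gV : ((ϖ' : ℚ) : ℝ) * W'.realPeriodRat = plusPeriod gV := by rw [hgVper]; exact hϖ'
  -- the dual datum of `V` over `K_∞⁺`
  let DKV : (V.baseChange K).SelmerDualData κK γK := (V.baseChange K).selmerDualData κK h.gen
  -- degenerate periods are contradictory
  by_cases h0 : ϖ * ϖ' = 0
  · exfalso
    obtain ⟨-, G, hG, hιG⟩ := hV (ϖ / r) hϖV V' ⟨C', hC'⟩ gV hgV (ϖ' / r') hϖV' DKV
    have hq : (ϖ / r * (ϖ' / r') : ℚ) = 0 := by
      rw [div_mul_div_comm, h0, zero_div]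
    have hG0 : G = 0 := by
      apply iwasawaToPowerSeries_injective p
      rw [hιG, hq, Rat.cast_zero, map_zero, zero_mul, map_zero]
    rw [hG0, Ideal.span_singleton_eq_bot.mpr rfl] at hG
    exact Module.charIdeal_ne_bot (IwasawaAlgebra p) DKV.X hG
  obtain ⟨hϖ0, hϖ'0⟩ := mul_ne_zero_iff.mp h0
  -- non-vanishing of the Kato–Wuthrich elements (Rohrlich)
  have hCne : ∀ {q : ℚ}, q ≠ 0 → ∀ {L : PowerSeries ℚ_[p]}, L ≠ 0 → ∀ {a : IwasawaAlgebra p},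
      iwasawaToPowerSeries p a = PowerSeries.C ((q : ℚ) : ℚ_[p]) * L → a ≠ 0 := by
    intro q hq L hL a ha h0a
    rw [h0a, map_zero] at ha
    have hC0 : PowerSeries.C ((q : ℚ) : ℚ_[p]) ≠ 0 := by
      intro hc
      have : ((q : ℚ) : ℚ_[p]) = 0 := by simpa using congrArg PowerSeries.constantCoeff hc
      exact hq (by exact_mod_cast this)
    exact mul_ne_zero hC0 hL ha.symm
  have hLfV : padicLFunction f (unitRoot V p : ℚ_[p]) ≠ 0 := padicLFunction_unitRoot_ne_zero hordV hfV
  have hLgV' : padicLFunction gV (unitRoot V' p : ℚ_[p]) ≠ 0 :=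
    padicLFunction_unitRoot_ne_zero hordV' hgV
  -- Mazur's equality over `ℚ_∞` at `V` (form `f`, period `ϖ/r`) and at `V'` (form `gV`, period `ϖ'/r'`)
  have hMCV : ∀ D₁ : V.SelmerDualData κ γ, D₁.IsTorsion ∧
      ∃ a : IwasawaAlgebra p, D₁.charIdeal = Ideal.span {a} ∧
        iwasawaToPowerSeries p a =
          PowerSeries.C ((ϖ / r : ℚ) : ℚ_[p]) * padicLFunction f (unitRoot V p : ℚ_[p]) := by
    intro D₁
    obtain ⟨hD₁t, a, ha, hιa⟩ := hW16 V p hp2 hordV hredV hκ hγ hγ' hfV D₁ (ϖ / r) hϖV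
    obtain ⟨-, b, hb, hιb⟩ := hW16 V' p hp2 hordV' hredV' hκ hγ hγ' hgV DV' (ϖ' / r') hϖV'
    obtain ⟨-, G, hG, hιG⟩ := hV (ϖ / r) hϖV V' ⟨C', hC'⟩ gV hgV (ϖ' / r') hϖV' DKV
    obtain ⟨-, hchar⟩ := CastellaGrossiSkinner2025.charIdeal_eq_mul_of_prop331 h331 V p hp2 hordV K hK
      hHV h.split V' ⟨C', hC'⟩ κK γK κ γ h.cyc h.gen h.normalised hκ hγ hγ' DKV D₁ DV' hD₁t hDV't
    have hGeq : G = a * b := by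
      apply iwasawaToPowerSeries_injective p
      rw [map_mul, hιG, hιa, hιb, Rat.cast_mul, map_mul]
      ring
    have hb0 : b ≠ 0 := hCne (div_ne_zero hϖ'0 hr0') hLgV' hιb
    exact ⟨hD₁t, a, eq_span_singleton_of_mul_eq_span_mul ha hb hb0 (by rw [← hchar, hG, hGeq]), hιa⟩
  have hMCV' : ∀ D₁ : V'.SelmerDualData κ γ, D₁.IsTorsion ∧
      ∃ b : IwasawaAlgebra p, D₁.charIdeal = Ideal.span {b} ∧
        iwasawaToPowerSeries p b =
          PowerSeries.C ((ϖ' / r' : ℚ) : ℚ_[p]) * padicLFunction gV (unitRoot V' p : ℚ_[p]) := by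
    intro D₁
    obtain ⟨-, a, ha, hιa⟩ := hW16 V p hp2 hordV hredV hκ hγ hγ' hfV DV (ϖ / r) hϖV
    obtain ⟨hD₁t, b, hb, hιb⟩ := hW16 V' p hp2 hordV' hredV' hκ hγ hγ' hgV D₁ (ϖ' / r') hϖV'
    obtain ⟨-, G, hG, hιG⟩ := hV (ϖ / r) hϖV V' ⟨C', hC'⟩ gV hgV (ϖ' / r') hϖV' DKV
    obtain ⟨-, hchar⟩ := CastellaGrossiSkinner2025.charIdeal_eq_mul_of_prop331 h331 V p hp2 hordV K hK
      hHV h.split V' ⟨C', hC'⟩ κK γK κ γ h.cyc h.gen h.normalised hκ hγ hγ' DKV DV D₁ hDVt hD₁t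
    have hGeq : G = b * a := by
      apply iwasawaToPowerSeries_injective p
      rw [map_mul, hιG, hιa, hιb, Rat.cast_mul, map_mul]
      ring
    have ha0 : a ≠ 0 := hCne (div_ne_zero hϖ0 hr0) hLfV hιa
    refine ⟨hD₁t, b, eq_span_singleton_of_mul_eq_span_mul hb ha ha0 ?_, hιb⟩
    rw [mul_comm, ← hchar, hG, hGeq]
  -- Prop. 3.2.3 ("invariant under isogenies"): to `W` and to `W'`
  obtain ⟨g₁, hg₁, hι₁⟩ := CastellaGrossiSkinner2025.thmAConclusion_of_isIsogenous h323 hisoVW hp2 hordV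
    hordW hκ hγ hϖV hϖ hMCV DW hDWt
  obtain ⟨g₂, hg₂, hι₂⟩ := CastellaGrossiSkinner2025.thmAConclusion_of_isIsogenous h323 hiso' hp2 hordV'
    hordW' hκ hγ hϖV' hϖ'gV hMCV' DW' hDW't
  -- Prop. 3.3.1 at `W`
  obtain ⟨hDKt, hchar⟩ := CastellaGrossiSkinner2025.charIdeal_eq_mul_of_prop331 h331 W p hp2 hordW K hK
    h.heeg h.split W' ⟨C, hC⟩ κK γK κ γ h.cyc h.gen h.normalised hκ hγ hγ' DK DW DW' hDWt hDW't
  refine ⟨hDKt, g₁ * g₂, ?_, ?_⟩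
  · rw [hchar, hg₁, hg₂, Ideal.span_singleton_mul_span_singleton]
  · rw [map_mul, hι₁, hι₂, hgVL, Rat.cast_mul, map_mul]
    ring

end Summit.BirchSwinnertonDyer.BirchSwinnertonDyer.Theorems.InterludeWithTorsion

end
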